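/-
Copyright (c) 2026 the pub-hodgecm-mathlib formalisation cell (harness21).  Prover seat hodgecm-mathlib-R90-C10-p01 (g4), R90-TF SLAB section S1 «Ch10-local» (base
R90-C10), h413 = `stmt-HodgeConjecture-24833`; U4 :182 wild socket (S-W), cell (S-W-Rb); card (W-8) item (d) of this seat's census `R90/R90-C10-p01/g4/CENSUS-W8.v1.md`
(S1 dealer R90-C10-plan (g3) 03:47:38Z, line lead R90-C10-p05 (g3)): «THE WILD CASSELMAN-PAIR DETERMINANT IN CLOSED FORM, TWO SMALL-CELL EXPONENTS» — pure algebra, the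
wild twin of ★ (B-10)(7) `R90S1BposRamDeterminantClosedForm` (this base, g3).  2026-09-05.
-/
import Summits.HodgeConjecture.HodgeConjecture.Theorems.R90S1BposRamDeterminantClosedForm   -- ★ (B-10)(7) p864034 (this base, g3): `det_letters_eq_ram_posDepth`, `eq_inv_of_det_eq_zero_ram_posDepth`; brings ★ Z4-ram `det_eq_zero_iff_of_norm_lt_one_ram`, ★ `coe_halfModulusChar_norm_uniformizer`, Mathlib `one_lt_absNorm`
import Summits.HodgeConjecture.HodgeConjecture.Theorems.R90S1BposRamConversionWild         -- ★ (W-2′) p865037 (R90-C10-p04 (g3)): `exists_eta_of_branchB_of_exists_root_of_fixedUnit` (root at SOME uniformiser unit + `hB` + `hFε` ⟹ `η`; no `|2|_w = 1`, no parity of `d`)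
import HarnessLib

/-!
# R90-TF · S1 (Rogawski 1990 Ch. 12, local) — (W-8)(d) `R90S1WildDeterminantClosedForm`: the Casselman-pair determinant with TWO small-cell exponents and TWO Γ-constants — `det M = 0 ⟹ X = q⁻¹`, wild-ready

Cell hodgecm-mathlib, slab R90-TF (director brief v2), section S1 «Ch10-local» (base R90-C10), crux h413 = stmt-HodgeConjecture-24833 (lane `--supports … --as helper`),
route `route-HodgeConjecture-HCCMUnconditional` (no route verbs).  U4 :182 wild socket (S-W), cell (S-W-Rb) of K2E3's ED. 13 split; card (W-8) item (d) of this seat's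
census `CENSUS-W8.v1.md` (letter shape `hShellW` + honest gap list).  THEOREMS ONLY (no `def`, no `instance`, no notation, no named fact, no `sorry`); ★-only imports.

THE POINT.  The (R-b) determinant road ends in pure algebra: the four Casselman-pair entries of the `(J_e, θ)`-plane are `Λ_1 f₁ = V₁·Γ₁·X∕(1−X)`, `Λ_{w₀} f_w = V₂·Γ₂·X∕(1−X)`
(big cells: geometric sums of cut shells), `Λ_1 f_w = (q^{e₁})⁻¹·V₁`, `Λ_{w₀} f₁ = (q^{e₂})⁻¹·V₂` (small cells: box masses), with a constant relation tying `Γ₁Γ₂` to `X`.  At a TAME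
place ★ (7) has `e₁ = e₂ = ν`, `Γ₁ = Γ₂ = Γ`, `Γ²X = (q−1)²(q^{2ν+1})⁻¹`.  At a WILD place (census (W-8) §2–§3) the level datum is `e_W = (⌈n∕2⌉, d−1; ⌊n∕2⌋, d)` (★ (W-3b)),
the two boxes may differ (`V₁ ≠ V₂` for odd `n`), and the two columns carry their own exponents `e₁, e₂` and constants `Γ₁, Γ₂` — whatever P-wild-1 delivers.  THIS FILE shows the
closed form and the root are EXPONENT-FREE: with `Γ₁·Γ₂·X = (q−1)²·(q^{e₁+e₂+1})⁻¹`,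
  `det M = Λ11·Λww − Λw1·Λ1w = V₁V₂·((q^{e₁})⁻¹(q^{e₂})⁻¹·q) · ((q−1)²(q²)⁻¹·X·((1−X)²)⁻¹ − q⁻¹)`
— the SAME bracket as ★ (7) ∕ ★ Z3-ram (`= −(qX−1)(X−q)∕(q²(1−X)²)`), so `det M = 0`, `|X| < 1 < q` force **`X = q⁻¹`** (★ Z4-ram `det_eq_zero_iff_of_norm_lt_one_ram`), and then
★ (W-2′) §4 converts the root at a uniformiser unit into `χ₁ = η·‖·‖^{1∕2}`.  So the (S-W-Rb) producer owes ONLY the five letters (census (W-8) §3 `hShellW` ⟹ §4 (d)); the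
CONSISTENCY TEST of the census (at `χ₁ = η‖·‖^{1∕2}` the C-relations must give `X = q⁻¹`) is this file read backwards.
* §1 `det_letters_eq_wild` — the closed form with `(e₁, e₂, Γ₁, Γ₂, V₁, V₂)` free (junction `example`: ★ (7)'s tame form is the instance `e₁ = e₂ = ν`, `Γ₁ = Γ₂`).
* §2 `eq_inv_of_det_eq_zero_wild` — the root `X = q⁻¹`; `det_ne_zero_of_bigCell_zero_wild` — the (R-a) cell: both big-cell entries `0` ⟹ `det ≠ 0`.
* §3 CM letters (`q = N𝔓_w`, `X = χ₁(σΠ·Π)` at a uniformiser unit `Π`): `apply_norm_uniformizer_eq_halfModulusChar_of_det_eq_zero_wild` (the ROOT in ★ (W-5)'s `HWRb`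
  currency: `χ₁(σΠ·Π) = halfModulusChar(σΠ·Π)`), `exists_root_of_det_eq_zero_wild` (`HWRb`'s ∃-conclusion shape VERBATIM), `exists_eta_of_det_eq_zero_of_pairEntries_wild`
  (Branch B + `hFε` ⟹ `∃ η`, via ★ (W-2′) §4).

HONEST LABEL.  HC_CM is proved only modulo the 7 printed citations (2 remaining named inputs: hLiu418 = stmt-HodgeConjecture-24832, h413 = stmt-HodgeConjecture-24833) until
rung 0 closes; count-neutral INFRASTRUCTURE (pure algebra + two ★ calls) — pays NO socket; the five letters are OWED by the wild type side ((W-8) §4 (c)) and P-wild-1;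
(S-W-Rb) OPEN, (S-W-A)∕(S-W-Ra) XL; :182 ∕ C :88∕:98 ∕ A2′ OPEN; REL ≠ ★ ≠ BUILT.

## References
* [Keys1984] D. Keys, *Principal series representations of special unitary groups over local fields*, Compositio Math. 51 (1984), §3, §7 Theorem (2) (d) p. 126.
* [Casselman1980] W. Casselman, *The unramified principal series of p-adic groups I*, Compositio Math. 40 (1980), §3 (the rank-one intertwining determinant on a type).
* [Roche1998] A. Roche, *Types and Hecke algebras for principal series representations of split reductive p-adic groups*, Ann. Sci. ÉNS (4) 31 (1998), §3–§4.
* [Rogawski1990] J. D. Rogawski, *Automorphic Representations of Unitary Groups in Three Variables*, Ann. of Math. Stud. 123 (1990), §12.2 (1)–(2) p. 173.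
-/

set_option autoImplicit false
-- the mandated namespace has the single-problem summit's repeated segment (`HodgeConjecture.HodgeConjecture`)
set_option linter.dupNamespace false

noncomputable section

open NumberField IsDedekindDomain
open scoped WithZero Valued NNReal
open Literature.NumberTheory Literature.NumberTheory.Automorphic Literature.NumberTheory.Automorphic.UnitaryGroup

namespace Summit.HodgeConjecture.HodgeConjecture.R90.S1.WildDeterminantClosedForm

open Summit.HodgeConjecture.HodgeConjecture.Cruxes.H413 Summit.HodgeConjecture.HodgeConjecture.R90.S1

/-! ## §1 The closed form with two small-cell exponents and two Γ-constants -/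

/-- **`det M` IN CLOSED FORM, TWO EXPONENTS.**  With `Λ11 = V₁·Γ₁·X∕(1−X)`, `Λww = V₂·Γ₂·X∕(1−X)`, `Λ1w = (q^{e₁})⁻¹·V₁`, `Λw1 = (q^{e₂})⁻¹·V₂`,
`Γ₁·Γ₂·X = (q−1)²·(q^{e₁+e₂+1})⁻¹`, `q ≠ 0`, `1 − X ≠ 0`:
`Λ11·Λww − Λw1·Λ1w = V₁V₂·((q^{e₁})⁻¹(q^{e₂})⁻¹·q) · ((q−1)²(q²)⁻¹·X·((1−X)²)⁻¹ − q⁻¹)` — the bracket of ★ (7) `det_letters_eq_ram_posDepth` ∕ ★ Z3-ram, exponent-free.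
[cite: Keys1984, §7 Theorem (2) (d) p. 126] [cite: Casselman1980, §3] [cite: Roche1998, §3–§4] -/
theorem det_letters_eq_wild (q X Γ₁ Γ₂ V₁ V₂ Λ11 Λ1w Λw1 Λww : ℂ) (e₁ e₂ : ℕ) (hq : q ≠ 0) (hX1 : 1 - X ≠ 0)
    (h11 : Λ11 = V₁ * (Γ₁ * X / (1 - X))) (hww : Λww = V₂ * (Γ₂ * X / (1 - X)))
    (h1w : Λ1w = (q ^ e₁)⁻¹ * V₁) (hw1 : Λw1 = (q ^ e₂)⁻¹ * V₂)
    (hΓ : Γ₁ * Γ₂ * X = (q - 1) ^ 2 * (q ^ (e₁ + e₂ + 1))⁻¹) :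
    Λ11 * Λww - Λw1 * Λ1w = (V₁ * V₂ * ((q ^ e₁)⁻¹ * (q ^ e₂)⁻¹ * q)) * ((q - 1) ^ 2 * (q ^ 2)⁻¹ * X * ((1 - X) ^ 2)⁻¹ - q⁻¹) := by
  have hprod : Λ11 * Λww = V₁ * V₂ * (Γ₁ * Γ₂ * X) * X * ((1 - X) ^ 2)⁻¹ := by
    rw [h11, hww]
    field_simp
  rw [hprod, hΓ, h1w, hw1, pow_add, pow_add, pow_one]
  field_simp

/-- JUNCTION (not a theorem — it IS ★ (7) `det_letters_eq_ram_posDepth`'s statement): ★ (7)'s TAME closed form is the instance `e₁ = e₂ = ν`, `Γ₁ = Γ₂ = Γ` of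
`det_letters_eq_wild` (`Γ²X = ΓΓX`, `q^{2ν+1} = q^{ν+ν+1}`, `(q^ν)⁻¹(q^ν)⁻¹ = ((q^ν)⁻¹)²`). [cite: Keys1984, §7 Theorem (2) (d) p. 126] -/
example (q X Γ V₁ V₂ Λ11 Λ1w Λw1 Λww : ℂ) (ν : ℕ) (hq : q ≠ 0) (hX1 : 1 - X ≠ 0)
    (h11 : Λ11 = V₁ * (Γ * X / (1 - X))) (hww : Λww = V₂ * (Γ * X / (1 - X)))
    (h1w : Λ1w = (q ^ ν)⁻¹ * V₁) (hw1 : Λw1 = (q ^ ν)⁻¹ * V₂)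
    (hΓ : Γ ^ 2 * X = (q - 1) ^ 2 * (q ^ (2 * ν + 1))⁻¹) :
    Λ11 * Λww - Λw1 * Λ1w = (V₁ * V₂ * (((q ^ ν)⁻¹) ^ 2 * q)) * ((q - 1) ^ 2 * (q ^ 2)⁻¹ * X * ((1 - X) ^ 2)⁻¹ - q⁻¹) := by
  rw [det_letters_eq_wild q X Γ Γ V₁ V₂ Λ11 Λ1w Λw1 Λww ν ν hq hX1 h11 hww h1w hw1
    (by rw [show ν + ν + 1 = 2 * ν + 1 by ring, ← hΓ]; ring)]
  ring

/-! ## §2 The admissible root, and the (R-a) non-vanishing -/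

/-- **THE ROOT FROM THE FIVE WILD LETTERS.**  For real `q > 1`, `|X| < 1`, `V₁, V₂ ≠ 0`, entries and constant relation as in `det_letters_eq_wild` (any `e₁ e₂ Γ₁ Γ₂`):
`det M = 0` forces **`X = q⁻¹`** (divide by `V₁V₂(q^{e₁})⁻¹(q^{e₂})⁻¹q ≠ 0`, then ★ Z4-ram `det_eq_zero_iff_of_norm_lt_one_ram`: `(qX−1)(X−q) = 0` with `X = q` excluded by `|X| < 1 < q`).
[cite: Keys1984, §7 Theorem (2) (d) p. 126] [cite: Casselman1980, §3] [cite: Rogawski1990, §12.2 (1)–(2) p. 173] -/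
theorem eq_inv_of_det_eq_zero_wild (q : ℝ) (hq : 1 < q) (e₁ e₂ : ℕ) (X Γ₁ Γ₂ V₁ V₂ Λ11 Λ1w Λw1 Λww : ℂ) (hX : ‖X‖ < 1)
    (hV₁ : V₁ ≠ 0) (hV₂ : V₂ ≠ 0)
    (h11 : Λ11 = V₁ * (Γ₁ * X / (1 - X))) (hww : Λww = V₂ * (Γ₂ * X / (1 - X)))
    (h1w : Λ1w = ((q : ℂ) ^ e₁)⁻¹ * V₁) (hw1 : Λw1 = ((q : ℂ) ^ e₂)⁻¹ * V₂)
    (hΓ : Γ₁ * Γ₂ * X = ((q : ℂ) - 1) ^ 2 * ((q : ℂ) ^ (e₁ + e₂ + 1))⁻¹)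
    (hdet : Λ11 * Λww - Λw1 * Λ1w = 0) :
    X = ((q : ℂ))⁻¹ := by
  have hq0 : (q : ℂ) ≠ 0 := by exact_mod_cast (ne_of_gt (lt_trans zero_lt_one hq))
  have hX1 : 1 - X ≠ 0 := by
    intro h
    have hXeq : X = 1 := by linear_combination -h
    rw [hXeq, norm_one] at hX
    exact lt_irrefl _ hX
  rw [det_letters_eq_wild (q : ℂ) X Γ₁ Γ₂ V₁ V₂ Λ11 Λ1w Λw1 Λww e₁ e₂ hq0 hX1 h11 hww h1w hw1 hΓ] at hdet
  have hpre : V₁ * V₂ * ((((q : ℂ) ^ e₁)⁻¹) * (((q : ℂ) ^ e₂)⁻¹) * (q : ℂ)) ≠ 0 :=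
    mul_ne_zero (mul_ne_zero hV₁ hV₂)
      (mul_ne_zero (mul_ne_zero (inv_ne_zero (pow_ne_zero e₁ hq0)) (inv_ne_zero (pow_ne_zero e₂ hq0))) hq0)
  have h := (mul_eq_zero.1 hdet).resolve_left hpre
  exact (det_eq_zero_iff_of_norm_lt_one_ram q hq X hX).1 h

/-- **(R-a) — both big-cell entries `0` ⟹ `det M = −(q^{e₁})⁻¹(q^{e₂})⁻¹·V₁V₂ ≠ 0`** (`q, V₁, V₂ ≠ 0`): the wild twin of ★ (7) `det_ne_zero_of_bigCell_zero_ram`; with ★ (B-0)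
«reducible ⟹ det M = 0» this is the (S-W-Ra) contradiction once the wild shells vanish. [cite: Keys1984, §7 Theorem (2) (d) p. 126] [cite: Casselman1980, §3] -/
theorem det_ne_zero_of_bigCell_zero_wild (q V₁ V₂ Λ11 Λ1w Λw1 Λww : ℂ) (e₁ e₂ : ℕ) (hq : q ≠ 0) (hV₁ : V₁ ≠ 0) (hV₂ : V₂ ≠ 0)
    (h11 : Λ11 = 0) (hww : Λww = 0) (h1w : Λ1w = (q ^ e₁)⁻¹ * V₁) (hw1 : Λw1 = (q ^ e₂)⁻¹ * V₂) :
    Λ11 * Λww - Λw1 * Λ1w ≠ 0 := by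
  rw [h11, hww, h1w, hw1, zero_mul, zero_sub, neg_ne_zero]
  exact mul_ne_zero (mul_ne_zero (inv_ne_zero (pow_ne_zero e₂ hq)) hV₂) (mul_ne_zero (inv_ne_zero (pow_ne_zero e₁ hq)) hV₁)

/-! ## §3 The CM letters: `q = N𝔓_w`, `X = χ₁(σΠ·Π)` at a uniformiser unit `Π` of `R = L ⊗ L⁺_v` -/

section CM

variable (L : Type) [Field L] [NumberField L] [IsCMField L] (v : HeightOneSpectrum (𝓞 ↥(maximalRealSubfield L)))
  (hns : ∀ w : PlacesOver L v, IsCMField.complexConj L • w.1 = w.1) (w : PlacesOver L v) (hw : IsCMField.complexConj L • w.1 = w.1)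

include hns hw in
/-- **THE ROOT IN ★ (W-5)'s `HWRb` CURRENCY: `det M = 0 ⟹ χ₁(σΠ·Π) = halfModulusChar(σΠ·Π)`** at a uniformiser unit `Π` (`|Π_{w′}| = exp(−1)`), from the five wild letters
with `q = N𝔓_w` (`1 < q`, Mathlib `one_lt_absNorm`), `X = χ₁(σΠ·Π)`, `|X| < 1`: §2 gives `X = (N𝔓_w)⁻¹` and ★ `coe_halfModulusChar_norm_uniformizer` reads it as the root.
Valid at EVERY non-split place (no `|2|_w = 1`, no parity). [cite: Keys1984, §7 Theorem (2) (d) p. 126] [cite: Casselman1980, §3] [cite: Rogawski1990, §12.2 (2) p. 173] -/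
theorem apply_norm_uniformizer_eq_halfModulusChar_of_det_eq_zero_wild
    (piU : (LocalRing L v)ˣ) (hpiU : ∀ w' : PlacesOver L v, Valued.v ((piU : LocalRing L v) w') = WithZero.exp (-1 : ℤ))
    (χ₁ : (LocalRing L v)ˣ →* ℂˣ) (e₁ e₂ : ℕ) (Γ₁ Γ₂ V₁ V₂ Λ11 Λ1w Λw1 Λww : ℂ) (hV₁ : V₁ ≠ 0) (hV₂ : V₂ ≠ 0)
    (hX : ‖((χ₁ (Units.map (conjLocal L (IsCMField.complexConj L) v : LocalRing L v →* LocalRing L v) piU * piU) : ℂˣ) : ℂ)‖ < 1)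
    (h11v : Λ11 = V₁ * (Γ₁ * ((χ₁ (Units.map (conjLocal L (IsCMField.complexConj L) v : LocalRing L v →* LocalRing L v) piU * piU) : ℂˣ) : ℂ) /
      (1 - ((χ₁ (Units.map (conjLocal L (IsCMField.complexConj L) v : LocalRing L v →* LocalRing L v) piU * piU) : ℂˣ) : ℂ))))
    (hwwv : Λww = V₂ * (Γ₂ * ((χ₁ (Units.map (conjLocal L (IsCMField.complexConj L) v : LocalRing L v →* LocalRing L v) piU * piU) : ℂˣ) : ℂ) /
      (1 - ((χ₁ (Units.map (conjLocal L (IsCMField.complexConj L) v : LocalRing L v →* LocalRing L v) piU * piU) : ℂˣ) : ℂ))))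
    (h1wv : Λ1w = (((Ideal.absNorm w.1.asIdeal : ℝ) : ℂ) ^ e₁)⁻¹ * V₁) (hw1v : Λw1 = (((Ideal.absNorm w.1.asIdeal : ℝ) : ℂ) ^ e₂)⁻¹ * V₂)
    (hΓ : Γ₁ * Γ₂ * ((χ₁ (Units.map (conjLocal L (IsCMField.complexConj L) v : LocalRing L v →* LocalRing L v) piU * piU) : ℂˣ) : ℂ) =
      (((Ideal.absNorm w.1.asIdeal : ℝ) : ℂ) - 1) ^ 2 * ((((Ideal.absNorm w.1.asIdeal : ℝ) : ℂ)) ^ (e₁ + e₂ + 1))⁻¹)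
    (hdet : Λ11 * Λww - Λw1 * Λ1w = 0) :
    χ₁ (Units.map (conjLocal L (IsCMField.complexConj L) v : LocalRing L v →* LocalRing L v) piU * piU) =
      halfModulusChar (LocalRing L v) (Units.map (conjLocal L (IsCMField.complexConj L) v : LocalRing L v →* LocalRing L v) piU * piU) := by
  have hq : (1 : ℝ) < (Ideal.absNorm w.1.asIdeal : ℝ) := by exact_mod_cast NumberField.HeightOneSpectrum.one_lt_absNorm w.1
  have hroot0 := eq_inv_of_det_eq_zero_wild (Ideal.absNorm w.1.asIdeal : ℝ) hq e₁ e₂ _ Γ₁ Γ₂ V₁ V₂ Λ11 Λ1w Λw1 Λww hX hV₁ hV₂ h11v hwwv h1wv hw1v hΓ hdet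
  rw [Complex.ofReal_natCast] at hroot0
  exact Units.ext (by rw [hroot0, coe_halfModulusChar_norm_uniformizer L v hns w hw piU hpiU])

include hns hw in
/-- **`HWRb`'s ∃-CONCLUSION SHAPE from the five wild letters** (★ (W-5) :101–:103 VERBATIM: `∃ piU, (∀ w′, |piU_{w′}| = exp(−1)) ∧ χ₁(σ piU·piU) = halfModulusChar(σ piU·piU)`),
witnessed by the frame's own uniformiser unit. [cite: Keys1984, §7 Theorem (2) (d) p. 126] [cite: Rogawski1990, §12.2 (2) p. 173] -/
theorem exists_root_of_det_eq_zero_wild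
    (piU : (LocalRing L v)ˣ) (hpiU : ∀ w' : PlacesOver L v, Valued.v ((piU : LocalRing L v) w') = WithZero.exp (-1 : ℤ))
    (χ₁ : (LocalRing L v)ˣ →* ℂˣ) (e₁ e₂ : ℕ) (Γ₁ Γ₂ V₁ V₂ Λ11 Λ1w Λw1 Λww : ℂ) (hV₁ : V₁ ≠ 0) (hV₂ : V₂ ≠ 0)
    (hX : ‖((χ₁ (Units.map (conjLocal L (IsCMField.complexConj L) v : LocalRing L v →* LocalRing L v) piU * piU) : ℂˣ) : ℂ)‖ < 1)
    (h11v : Λ11 = V₁ * (Γ₁ * ((χ₁ (Units.map (conjLocal L (IsCMField.complexConj L) v : LocalRing L v →* LocalRing L v) piU * piU) : ℂˣ) : ℂ) /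
      (1 - ((χ₁ (Units.map (conjLocal L (IsCMField.complexConj L) v : LocalRing L v →* LocalRing L v) piU * piU) : ℂˣ) : ℂ))))
    (hwwv : Λww = V₂ * (Γ₂ * ((χ₁ (Units.map (conjLocal L (IsCMField.complexConj L) v : LocalRing L v →* LocalRing L v) piU * piU) : ℂˣ) : ℂ) /
      (1 - ((χ₁ (Units.map (conjLocal L (IsCMField.complexConj L) v : LocalRing L v →* LocalRing L v) piU * piU) : ℂˣ) : ℂ))))
    (h1wv : Λ1w = (((Ideal.absNorm w.1.asIdeal : ℝ) : ℂ) ^ e₁)⁻¹ * V₁) (hw1v : Λw1 = (((Ideal.absNorm w.1.asIdeal : ℝ) : ℂ) ^ e₂)⁻¹ * V₂)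
    (hΓ : Γ₁ * Γ₂ * ((χ₁ (Units.map (conjLocal L (IsCMField.complexConj L) v : LocalRing L v →* LocalRing L v) piU * piU) : ℂˣ) : ℂ) =
      (((Ideal.absNorm w.1.asIdeal : ℝ) : ℂ) - 1) ^ 2 * ((((Ideal.absNorm w.1.asIdeal : ℝ) : ℂ)) ^ (e₁ + e₂ + 1))⁻¹)
    (hdet : Λ11 * Λww - Λw1 * Λ1w = 0) :
    ∃ piU : (LocalRing L v)ˣ, (∀ w' : PlacesOver L v, Valued.v ((piU : LocalRing L v) w') = WithZero.exp (-1 : ℤ)) ∧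
      χ₁ (Units.map (conjLocal L (IsCMField.complexConj L) v : LocalRing L v →* LocalRing L v) piU * piU) =
        halfModulusChar (LocalRing L v) (Units.map (conjLocal L (IsCMField.complexConj L) v : LocalRing L v →* LocalRing L v) piU * piU) :=
  ⟨piU, hpiU, apply_norm_uniformizer_eq_halfModulusChar_of_det_eq_zero_wild L v hns w hw piU hpiU χ₁ e₁ e₂ Γ₁ Γ₂ V₁ V₂ Λ11 Λ1w Λw1 Λww hV₁ hV₂
    hX h11v hwwv h1wv hw1v hΓ hdet⟩

include hns hw in
/-- **THE END ASSEMBLY, BRANCH B, SUB-BRANCH (R-b), WILD-READY: `det M = 0 ⟹ χ₁ = η·‖·‖^{1∕2}`** — `χ₁` continuous with `χ₁(u·σu) = 1` on the units of modulus one (`hB`) and a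
σ-fixed unit `a` of modulus one with `χ₁ a ≠ 1` (`hFε`); the five wild letters at a uniformiser unit `Π` with `|X| < 1`; then `∃ η, IsQuadraticCharExtension σ η ∧ Continuous η ∧
χ₁ = η·halfModulusChar` (§3 root + ★ (W-2′) §4 `exists_eta_of_branchB_of_exists_root_of_fixedUnit`).  The wild twin of ★ (7) §3; no `|2|_w = 1`, no parity of `n` or `d`.
[cite: Keys1984, §7 Theorem (2) (d) p. 126] [cite: Casselman1980, §3] [cite: Rogawski1990, §12.2 (2) p. 173; §4.8 p. 51] [cite: Serre1979, Ch. V §3 Prop. 5 Cor. 3] -/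
theorem exists_eta_of_det_eq_zero_of_pairEntries_wild
    (piU : (LocalRing L v)ˣ) (hpiU : ∀ w' : PlacesOver L v, Valued.v ((piU : LocalRing L v) w') = WithZero.exp (-1 : ℤ))
    (χ₁ : (LocalRing L v)ˣ →* ℂˣ) (h₁ : Continuous (fun x => ((χ₁ x : ℂˣ) : ℂ)))
    (hB : ∀ u : (LocalRing L v)ˣ, (∀ w' : PlacesOver L v, Valued.v ((u : LocalRing L v) w') = 1) →
      χ₁ (u * Units.map (conjLocal L (IsCMField.complexConj L) v : LocalRing L v →* LocalRing L v) u) = 1)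
    (hFε : ∃ a : (LocalRing L v)ˣ, Units.map (conjLocal L (IsCMField.complexConj L) v : LocalRing L v →* LocalRing L v) a = a ∧
      (∀ w' : PlacesOver L v, Valued.v ((a : LocalRing L v) w') = 1) ∧ χ₁ a ≠ 1)
    (e₁ e₂ : ℕ) (Γ₁ Γ₂ V₁ V₂ Λ11 Λ1w Λw1 Λww : ℂ) (hV₁ : V₁ ≠ 0) (hV₂ : V₂ ≠ 0)
    (hX : ‖((χ₁ (Units.map (conjLocal L (IsCMField.complexConj L) v : LocalRing L v →* LocalRing L v) piU * piU) : ℂˣ) : ℂ)‖ < 1)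
    (h11v : Λ11 = V₁ * (Γ₁ * ((χ₁ (Units.map (conjLocal L (IsCMField.complexConj L) v : LocalRing L v →* LocalRing L v) piU * piU) : ℂˣ) : ℂ) /
      (1 - ((χ₁ (Units.map (conjLocal L (IsCMField.complexConj L) v : LocalRing L v →* LocalRing L v) piU * piU) : ℂˣ) : ℂ))))
    (hwwv : Λww = V₂ * (Γ₂ * ((χ₁ (Units.map (conjLocal L (IsCMField.complexConj L) v : LocalRing L v →* LocalRing L v) piU * piU) : ℂˣ) : ℂ) /
      (1 - ((χ₁ (Units.map (conjLocal L (IsCMField.complexConj L) v : LocalRing L v →* LocalRing L v) piU * piU) : ℂˣ) : ℂ))))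
    (h1wv : Λ1w = (((Ideal.absNorm w.1.asIdeal : ℝ) : ℂ) ^ e₁)⁻¹ * V₁) (hw1v : Λw1 = (((Ideal.absNorm w.1.asIdeal : ℝ) : ℂ) ^ e₂)⁻¹ * V₂)
    (hΓ : Γ₁ * Γ₂ * ((χ₁ (Units.map (conjLocal L (IsCMField.complexConj L) v : LocalRing L v →* LocalRing L v) piU * piU) : ℂˣ) : ℂ) =
      (((Ideal.absNorm w.1.asIdeal : ℝ) : ℂ) - 1) ^ 2 * ((((Ideal.absNorm w.1.asIdeal : ℝ) : ℂ)) ^ (e₁ + e₂ + 1))⁻¹)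
    (hdet : Λ11 * Λww - Λw1 * Λ1w = 0) :
    ∃ η : (LocalRing L v)ˣ →* ℂˣ, IsQuadraticCharExtension (conjLocal L (IsCMField.complexConj L) v) η ∧
      Continuous (fun x => ((η x : ℂˣ) : ℂ)) ∧ χ₁ = η * halfModulusChar (LocalRing L v) :=
  BposRamConversionWild.exists_eta_of_branchB_of_exists_root_of_fixedUnit L v hns w hw χ₁ h₁ hB
    (exists_root_of_det_eq_zero_wild L v hns w hw piU hpiU χ₁ e₁ e₂ Γ₁ Γ₂ V₁ V₂ Λ11 Λ1w Λw1 Λww hV₁ hV₂ hX h11v hwwv h1wv hw1v hΓ hdet) hFε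

end CM

end Summit.HodgeConjecture.HodgeConjecture.R90.S1.WildDeterminantClosedForm

end
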